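import Literature.NumberTheory.LFunctions.Zhang2022.DetectorShiftMomentsDD
import Literature.NumberTheory.LFunctions.Zhang2022.DetectorShiftAdmissible

/-!
# Zhang (2022), programme F-S3 (cell landau-siegel, family B-det): ENTANGLED (multi-profile) detectors of
# class DET, their block main-term form `hᵀ·BigF(a;Π)·h`, and the estimate row det-E15 «E-det-cone»
# (registry E-102) as a predicate

Y. Zhang, *Discrete mean estimates and the Landau–Siegel zero*, arXiv:2211.02515v1 [Zhang2022LandauSiegel] —
an unrefereed manuscript under adjudication. **WHAT THIS IS NOT: not a claim about Theorems 1–2 of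
arXiv:2211.02515, about Landau–Siegel zeros, or about Parity; nothing here asserts any claim of the manuscript,
and nothing here asserts the row det-E15 — it is the OPEN row named by the family word of record, typed as a
predicate with explicit parameters so that the word, the design map and the §E intake can cite a declaration.**
«The programme SEARCHES and TYPES; no claim about Landau–Siegel zeros, Theorems 1–2 of arXiv:2211.02515 or a
repaired Margin232 until a kernel theorem says so.»

Sources of the row (cell documents, not literature): the theory ruling (c1) of 2026-08-26T21:21:49Z points
(4)–(6) (configuration-positivity replaces the fence model inside DET; the SOS cone), the strategist's design memo
`B-det/plan/D2PLUS-SPEC.md` v1.0.1 (ae9255608ee5e04d) §1 (two-profile ENTANGLED detectors, the block moment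
matrix `BigF(a;Π)`), §5 A1–A4, the referee rulings R-d2p-1…4 (2026-08-26T22:09:15Z), `B-det/EDLIST.md` v1.3 row
det-E15 and `B-det/KILL-draft.md` v1.7 §1a (the spoken word «… GIVEN det-E15 E-det-cone on the continuum»).

**The objects.** Fix an ANCHOR shift multiple `a` (the memo: `b_a ∈ (0,1)`, so that the anchor variable
`x_a = M(ρ+iαa,ψ)/(iαM′(ρ,ψ))` is `> 0` on every Prop-2.2 configuration), a PALETTE `b : Fin K → (0,5)` of
further shift multiples (any gaps; repeats and `b_j = a` allowed) and one-sided kinked top-vanishing profiles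
`h_j` (`Repair.KinkedProfile`, `h_j(1) = 0`). The entangled detector
`𝒟(a;b;h) = Σ_ψ Σ_ρ (iM′)²α³ · x_a · |Σ_j x_j A_{h_j}|² · ω` has weight·statistic `≥ 0` on EVERY configuration
(no Lemma-2.3 sign pattern on the palette is needed), and expands as the double sum over `(j,l)` of the class-DET
monomial means with shift triple `(a, b_j, b_l)` and profile pair `(h_j, h_l)` — so by the cell's (sign-blind,
desk-reviewed) main-term derivation E-010(i) + the repeated-shift rule «double pole = confluent divided
difference» (`Det.FormDetPolarDD`, file `DetectorShiftMomentsDD`) its (A)-main term is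
`m(a;b;h) = Σ_j Σ_l P^{dd}_{(a,b_j,b_l)}(h_j,h_l) = hᵀ·BigF(a;b)·h` (`Det.entangledMain`). This file TYPES that
bookkeeping; it does not assert the derivation (registry rows E-010(i), E-080 = det-E2).

* Part 1 — the confluent divided difference `Det.dd2` and the six dd-moments are SYMMETRIC under swapping the two
  palette entries of a triple `(a,x,y)` (`dd2_swap_right`, `ddOf_swap`, `formDetPolarDD_swap`), and the polar
  block is Hermitian in the profile pair (`formDetPolarDD_conj`); the diagonal value is the recipe form:
  `Re P^{dd}_b(g,g) = FormDetDD b g` for EVERY real triple (`formDetPolarDD_self_re`, via the parametric identity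
  `sixMomentOf_eq_two_mul_re_mformOf`).
* Part 2 — `Det.entangledMain a b h h′` (the block form) is REAL (`entangledMain_conj`, `entangledMain_im`);
  `K = 1` is the repeated-shift monomial `X_a·X_x²` (`entangledMain_fin_one`); profiles vanishing identically
  contribute nothing (`formDetPolarDD_zero_left/right`), whence PRINCIPAL SUB-PALETTES: the block form of a
  sub-palette `b ∘ σ` (`σ` injective) is the block form of `b` on the zero-extended profile vector
  (`entangledMain_comp_eq`); the RANK-ONE slice `h_j = q_j•g` is the quadratic form
  `Σ_{j,l} q_j conj(q_l)·FormDetDD(a,b_j,b_l)(g)` of theory's SOS family `X_a·|Σ_j q_jX_j|²` (`entangledMain_rankOne`).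
* Part 3 — statement vocabulary (bare `Prop`s, none asserted): `Det.ConePSD a b` («`BigF(a;b) ⪰ 0` on one-sided
  kinked profiles» — one MEMBER of the row, decidable in-house by certified eigen-bounds on the Legendre classes),
  `Det.ConeNegWitness a b` (its negation with a witness = the CANDIDATE event of R-d2p-1, `not_conePSD_iff`),
  **`Det.EdetCone A B`** (det-E15 ON an anchor set `A` and a shift box `B`: every member with `a ∈ A`, palette in
  `B`; the row of record is `EdetCone (Set.Ioo 0 1) (Set.Ioo 0 5)`, the scanned grid of det-D2⁺ is
  `A = {¼,½,¾}`, `B = ¼ℤ ∩ (0,5)`); PROVED API: monotonicity in `(A,B)` (`EdetCone.mono`), inheritance by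
  sub-palettes (`ConePSD.comp`), the diagonal/`K = 1` members (`ConePSD.formDetDD_nonneg`, `conePSD_fin_one_iff`),
  and the design record `Det.EntangledDesign K` with `EntangledDesign.mainTerm` and `EntangledDesign.conePSD`.
* Part 4 — the DISCRETE side, PROVED: the entangled statistic `Ξ_{w·x_a}(u,u)`, `u = Σ_j x_jA_j`, is `≥ 0` for
  weights `w ≥ 0`, `x_a ≥ 0` (`entangledStat_re_nonneg`) and EXPANDS as the double sum of the monomial-weight
  means `Ξ_{w x_a x_j x_l}(A_j, A_l)` (`entangledStat_eq_sum`) — the class-membership sentence of R-d2p-2 («each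
  monomial involves ≤ 3 shifts; the derivation is monomial-wise linear»); and the main-order soundness of the POS
  endgame (`entangled_mainOrder_nonneg`: a non-negative statistic normalised by `X > 0` cannot tend to a negative
  limit), whose contrapositive `not_tendsto_of_neg` is the CANDIDATE CRITERION of D2PLUS-SPEC §1: a member with
  `Re m(a;b;h*) < 0` contradicts any asymptotic `𝒟 ∼ m·X` — i.e. would refute the conjunction (A) ∧ E-010(i) ∧
  repeated-shift rule ∧ det-E2 at main order.

* Part 5 (v2 append, referee rider F-E102-1 of 2026-08-26T23:55:40Z) — **the FULL premise of the word as ONE name.**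
  `EdetCone` types the ENTANGLED / repeated-shift continuum only: its `K = 1` content is the repeated triple `(a,x,x)`
  (`conePSD_fin_one_iff`) and a pair member yields for a DISTINCT triple `(a,x,y)` only the principal-minor bound
  `FormDetDD(a,x,y)² ≤ FormDetDD(a,x,x)·FormDetDD(a,y,y)`, never a sign. The D1 monomial continuum — «`𝔅_{R(b)} ⪰ 0` on
  one-sided kinked profiles for every sign-admissible distinct triple `b` in the box» — is the E-010(ii) ∀-slot, typed here as
  `Det.MonomialConePSD B` (per member = `Det.FormDetPSD (Det.shiftRecipe b)`, the slot `Repair.familyDetShift` displays;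
  in-tree members: `(1,2,3)` `Det.formDetPSD_shiftRecipe_std`, `(1/2;2,5/2)` `Det.formDetPSD_shiftRecipe_bStar`). The word's
  premise «det-E15 E-det-cone on the continuum» (monomial AND entangled generators) is the conjunction
  **`Det.EdetPremise A B := EdetCone A B ∧ MonomialConePSD B`**, row of record `EdetPremise (Set.Ioo 0 1) (Set.Ioo 0 5)`
  (`edetPremise_record_iff`); qualifier (b) of the word («unconditional when E-102 is discharged») discharges on BOTH conjuncts.

STATUS of det-E15 (EDLIST v1.3; ls-ref-1 22:09:21Z): OPEN, in-house («B-AH restricted to DET»; no print source —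
the nearest printed object is the manuscript's own positive form, Prop 7.1 = the member `a, (b_j) = 1, (2,3)` in
monomial guise, `Det.formDetPSD_zhang`); per member DECIDABLE by certified numerics (D1: the sign-admissible
monomial generators, 214 cells, two lineages; det-D2⁺: the block matrices on the quarter grid, pending at the time
of typing); the continuum statement is the named open row of the word. Price: per member S, continuum M–L,
verdict-inert. 0 named facts (every `Prop` here has explicit parameters), 0 sorries.

## References

* Y. Zhang, arXiv:2211.02515v1 (2022), §2 (2.13)–(2.17), Lemma 2.3 p. 6, Prop 7.1 p. 44 with (7.19)–(7.21),
  §8 (8.11)–(8.18). [cite: Zhang2022LandauSiegel, Prop 7.1 p. 44]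
* Cell documents (not literature): `B-det/plan/D2PLUS-SPEC.md` v1.0.1 §1, §5; `B-det/EDLIST.md` v1.3 row det-E15;
  `B-det/KILL-draft.md` v1.7 §1a, §2 (i′); theory ruling (c1) 2026-08-26T21:21:49Z (4)–(6).
-/

noncomputable section

open Complex Real ComplexConjugate Filter
open scoped Topology

namespace Literature.NumberTheory.LFunctions.Zhang2022

namespace Det

open Repair

/-! ### Part 1 — symmetry of the confluent divided differences; the polar block is Hermitian; diagonal = `FormDetDD` -/

/-- The confluent second divided difference is symmetric in its last two nodes (all coincidence cases) — the
recipe's residue sum `Σ_j ℛ_j` and its double-pole limits do not depend on the order of the shifts.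
[cite: Zhang2022LandauSiegel, proof of Prop 7.1, (7.19)–(7.21)] -/
theorem dd2_swap_right (h h' h'' : ℝ → ℂ) (x y z : ℝ) : dd2 h h' h'' x z y = dd2 h h' h'' x y z := by
  unfold dd2
  by_cases hxy : x = y
  · subst hxy
    by_cases hxz : x = z
    · subst hxz
      simp
    · have hzx : z ≠ x := fun e => hxz e.symm
      simp [hxz, hzx]
  · by_cases hyz : y = z
    · subst hyz
      simp [hxy]
    · by_cases hxz : x = z
      · subst hxz
        have hyx : y ≠ x := fun e => hxy e.symm
        simp [hxy, hyx]
      · have hzy : z ≠ y := fun e => hyz e.symm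
        have hzx : z ≠ x := fun e => hxz e.symm
        have hyx : y ≠ x := fun e => hxy e.symm
        simp only [ne_eq, hxz, not_false_eq_true, hzy, hxy, and_self, ↓reduceIte, hyz]
        push_cast
        ring

/-- `B(a,y,x) = B(a,x,y)`. [cite: Zhang2022LandauSiegel, Lemma 5.2 p.10] -/
theorem shiftB_swap (a x y : ℝ) : shiftB ![a, y, x] = shiftB ![a, x, y] := by
  simp only [shiftB, Matrix.cons_val_zero, Matrix.cons_val_one, Matrix.cons_val_two, Matrix.head_cons,
    Matrix.tail_cons]
  ring

/-- The dd-values `(x^k g_B)[a,x,y]` are symmetric in the two palette entries.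
[cite: Zhang2022LandauSiegel, proof of Prop 7.1, (7.19)–(7.21)] -/
theorem ddOf_swap (a x y : ℝ) (k : ℕ) : ddOf ![a, y, x] k = ddOf ![a, x, y] k := by
  simp only [ddOf, shiftB_swap a x y, Matrix.cons_val_zero, Matrix.cons_val_one, Matrix.cons_val_two,
    Matrix.head_cons, Matrix.tail_cons]
  exact dd2_swap_right _ _ _ a x y

/-- `m₀` is symmetric in the two palette entries. [cite: Zhang2022LandauSiegel, proof of Prop 7.1, (7.19)–(7.21)] -/
theorem ddM0_swap (a x y : ℝ) : ddM0 ![a, y, x] = ddM0 ![a, x, y] := ddOf_swap a x y 1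

/-- `m_b` is symmetric in the two palette entries. [cite: Zhang2022LandauSiegel, §8 (8.13)–(8.18)] -/
theorem ddMb_swap (a x y : ℝ) : ddMb ![a, y, x] = ddMb ![a, x, y] := ddOf_swap a x y 2

/-- `m_s` is symmetric in the two palette entries. [cite: Zhang2022LandauSiegel, §8 (8.13)–(8.18)] -/
theorem ddMs_swap (a x y : ℝ) : ddMs ![a, y, x] = ddMs ![a, x, y] := by
  rw [ddMs, ddMs, shiftB_swap a x y, ddM0_swap a x y, ddMb_swap a x y]

/-- `b₀b₁b₂` is symmetric in the two palette entries. [folklore] -/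
private theorem prod_swap (a x y : ℝ) :
    (![a, y, x] : Fin 3 → ℝ) 0 * (![a, y, x] : Fin 3 → ℝ) 1 * (![a, y, x] : Fin 3 → ℝ) 2
      = (![a, x, y] : Fin 3 → ℝ) 0 * (![a, x, y] : Fin 3 → ℝ) 1 * (![a, x, y] : Fin 3 → ℝ) 2 := by
  simp only [Matrix.cons_val_zero, Matrix.cons_val_one, Matrix.cons_val_two, Matrix.head_cons, Matrix.tail_cons]
  ring

/-- `m_n` is symmetric in the two palette entries. [cite: Zhang2022LandauSiegel, §8 (8.13)–(8.18)] -/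
theorem ddMn_swap (a x y : ℝ) : ddMn ![a, y, x] = ddMn ![a, x, y] := by
  rw [ddMn, ddMn, prod_swap a x y, ddOf_swap a x y]

/-- `m_bs` is symmetric in the two palette entries. [cite: Zhang2022LandauSiegel, §8 (8.13)–(8.18)] -/
theorem ddMbs_swap (a x y : ℝ) : ddMbs ![a, y, x] = ddMbs ![a, x, y] := by
  rw [ddMbs, ddMbs, shiftB_swap a x y, ddMb_swap a x y, ddOf_swap a x y]

/-- `m_bn` is symmetric in the two palette entries. [cite: Zhang2022LandauSiegel, §8 (8.13)–(8.18)] -/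
theorem ddMbn_swap (a x y : ℝ) : ddMbn ![a, y, x] = ddMbn ![a, x, y] := by
  rw [ddMbn, ddMbn, prod_swap a x y, ddM0_swap a x y]

variable {g g' h h' : ℝ → ℂ}

/-- Formula I of the triple `(a,y,x)` is formula I of `(a,x,y)` (the block `(l,j)` uses the same moments as the
block `(j,l)`). [cite: Zhang2022LandauSiegel, Prop 7.1 p.44, (8.11)–(8.12)] -/
theorem mformDD_swap (a x y : ℝ) (g g' h h' : ℝ → ℂ) :
    MformDD ![a, y, x] g g' h h' = MformDD ![a, x, y] g g' h h' := by
  rw [MformDD, MformDD, ddM0_swap a x y, ddMs_swap a x y, ddMn_swap a x y, ddMb_swap a x y, ddMbs_swap a x y,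
    ddMbn_swap a x y]

/-- The polar block of `(a,y,x)` is the polar block of `(a,x,y)`. [cite: Zhang2022LandauSiegel, Prop 7.1 p.44, (8.11)–(8.12)] -/
theorem formDetPolarDD_swap (a x y : ℝ) (g g' h h' : ℝ → ℂ) :
    FormDetPolarDD ![a, y, x] g g' h h' = FormDetPolarDD ![a, x, y] g g' h h' := by
  rw [FormDetPolarDD, FormDetPolarDD, mformDD_swap a x y g g' h h', mformDD_swap a x y h h' g g']

/-- The polar block is HERMITIAN in the profile pair: `P^{dd}_b(h,g) = conj P^{dd}_b(g,h)`.
[cite: Zhang2022LandauSiegel, Prop 7.1 p.44, (8.11)–(8.12)] -/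
theorem formDetPolarDD_conj (b : Fin 3 → ℝ) (g g' h h' : ℝ → ℂ) :
    conj (FormDetPolarDD b g g' h h') = FormDetPolarDD b h h' g g' := by
  simp only [FormDetPolarDD, map_add, Complex.conj_conj, add_comm]

/-- The diagonal polar value is real: `Im P^{dd}_b(g,g) = 0`. [cite: Zhang2022LandauSiegel, Prop 7.1 p.44, (8.11)–(8.12)] -/
theorem formDetPolarDD_self_im (b : Fin 3 → ℝ) (g g' : ℝ → ℂ) : (FormDetPolarDD b g g' g g').im = 0 := by
  simp [FormDetPolarDD, Complex.add_im, Complex.conj_im]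

/-- **The six-moment expression is `2 Re` of the parametric formula I on the diagonal** — for ANY complex moments
and ANY profile (both sides are the same six terms; no apex or regularity hypothesis).
[cite: Zhang2022LandauSiegel, Prop 7.1 with (8.11)–(8.23), pp.44–50] -/
theorem sixMomentOf_eq_two_mul_re_mformOf (m0 ms mn mb mbs mbn : ℂ) (g g' : ℝ → ℂ) :
    SixMomentOf m0 ms mn mb mbs mbn g g' = 2 * (MformOf m0 ms mn mb mbs mbn g g' g g').re := by
  rw [SixMomentOf, MformOf, intervalIntegral_mul_conj_self g', intervalIntegral_mul_conj_self g]
  set A1 : ℝ := ∫ x in (0:ℝ)..1, ‖g' x‖ ^ 2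
  set A2 : ℂ := ∫ x in (0:ℝ)..1, g' x * conj (g x)
  set A4 : ℂ := ∫ x in (0:ℝ)..1, g x * conj (g' x)
  set A5 : ℝ := ∫ x in (0:ℝ)..1, ‖g x‖ ^ 2
  set B0 : ℂ := g 0 * conj (∫ x in (0:ℝ)..1, g x)
  set T7 : ℂ := (∫ x in (0:ℝ)..1, g x) * conj (∫ x in (0:ℝ)..1, g x)
    - ∫ x in (0:ℝ)..1, g x * conj (∫ t in (0:ℝ)..x, g t)
  have hπ : (π : ℝ) ≠ 0 := Real.pi_ne_zero
  simp only [Complex.mul_re, Complex.mul_im, Complex.add_re, Complex.add_im, Complex.sub_re, Complex.sub_im,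
    Complex.ofReal_re, Complex.ofReal_im, Complex.I_re, Complex.I_im]
  simp only [← Complex.ofReal_pow, Complex.ofReal_re, Complex.ofReal_im]
  field_simp
  ring

/-- **Diagonal of the polar block = the recipe form**, for EVERY real triple (repeats allowed):
`Re P^{dd}_b(g,g) = FormDetDD b g`. [cite: Zhang2022LandauSiegel, Prop 7.1 with (8.11)–(8.23), pp.44–50] -/
theorem formDetPolarDD_self_re (b : Fin 3 → ℝ) (g g' : ℝ → ℂ) :
    (FormDetPolarDD b g g' g g').re = FormDetDD b g g' := by
  rw [FormDetDD, sixMomentOf_eq_two_mul_re_mformOf, FormDetPolarDD, MformDD, Complex.add_re, Complex.conj_re]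
  ring

/-- A profile vanishing identically (with vanishing marked derivative) contributes nothing on the left …
[cite: Zhang2022LandauSiegel, Prop 7.1 p.44, (8.11)–(8.12)] -/
theorem mformOf_zero_left (m0 ms mn mb mbs mbn : ℂ) (h h' : ℝ → ℂ) :
    MformOf m0 ms mn mb mbs mbn 0 0 h h' = 0 := by
  simp [MformOf]

/-- … and nothing on the right. [cite: Zhang2022LandauSiegel, Prop 7.1 p.44, (8.11)–(8.12)] -/
theorem mformOf_zero_right (m0 ms mn mb mbs mbn : ℂ) (g g' : ℝ → ℂ) :
    MformOf m0 ms mn mb mbs mbn g g' 0 0 = 0 := by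
  simp [MformOf]

/-- `P^{dd}_b(0,h) = 0`. [cite: Zhang2022LandauSiegel, Prop 7.1 p.44, (8.11)–(8.12)] -/
theorem formDetPolarDD_zero_left (b : Fin 3 → ℝ) (h h' : ℝ → ℂ) : FormDetPolarDD b 0 0 h h' = 0 := by
  rw [FormDetPolarDD, MformDD, MformDD, mformOf_zero_left, mformOf_zero_right, map_zero, add_zero]

/-- `P^{dd}_b(g,0) = 0`. [cite: Zhang2022LandauSiegel, Prop 7.1 p.44, (8.11)–(8.12)] -/
theorem formDetPolarDD_zero_right (b : Fin 3 → ℝ) (g g' : ℝ → ℂ) : FormDetPolarDD b g g' 0 0 = 0 := by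
  rw [FormDetPolarDD, MformDD, MformDD, mformOf_zero_left, mformOf_zero_right, map_zero, add_zero]

/-! ### Homogeneity of the parametric formula I in each profile slot (for the rank-one slice) -/

/-- `∫₀¹ (c·f)·k = c·∫₀¹ f·k`. [folklore] -/
private theorem integral_const_mul_mul (c : ℂ) (f k : ℝ → ℂ) :
    (∫ x in (0:ℝ)..1, c * f x * k x) = c * ∫ x in (0:ℝ)..1, f x * k x := by
  rw [← intervalIntegral.integral_const_mul]
  exact intervalIntegral.integral_congr fun x _ => by ring

/-- `∫₀¹ f·(c·k) = c·∫₀¹ f·k`. [folklore] -/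
private theorem integral_mul_const_mul (c : ℂ) (f k : ℝ → ℂ) :
    (∫ x in (0:ℝ)..1, f x * (c * k x)) = c * ∫ x in (0:ℝ)..1, f x * k x := by
  rw [← intervalIntegral.integral_const_mul]
  exact intervalIntegral.integral_congr fun x _ => by ring

/-- Formula I is LINEAR-homogeneous in the left profile: `M(c•g, c•g′; h) = c·M(g;h)`.
[cite: Zhang2022LandauSiegel, Prop 7.1 p.44, (8.11)–(8.12)] -/
theorem mformOf_smul_left (m0 ms mn mb mbs mbn c : ℂ) (g g' h h' : ℝ → ℂ) :
    MformOf m0 ms mn mb mbs mbn (c • g) (c • g') h h' = c * MformOf m0 ms mn mb mbs mbn g g' h h' := by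
  simp only [MformOf, Pi.smul_apply, smul_eq_mul, integral_const_mul_mul, intervalIntegral.integral_const_mul]
  ring

/-- Formula I is CONJUGATE-homogeneous in the right profile: `M(g; c•h, c•h′) = conj c·M(g;h)`.
[cite: Zhang2022LandauSiegel, Prop 7.1 p.44, (8.11)–(8.12)] -/
theorem mformOf_smul_right (m0 ms mn mb mbs mbn c : ℂ) (g g' h h' : ℝ → ℂ) :
    MformOf m0 ms mn mb mbs mbn g g' (c • h) (c • h') = conj c * MformOf m0 ms mn mb mbs mbn g g' h h' := by
  simp only [MformOf, Pi.smul_apply, smul_eq_mul, map_mul, intervalIntegral.integral_const_mul,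
    integral_mul_const_mul]
  ring

/-- The polar block on scaled profiles: `P^{dd}_b(c•g, e•h) = c·conj e·P^{dd}_b(g,h)`.
[cite: Zhang2022LandauSiegel, Prop 7.1 p.44, (8.11)–(8.12)] -/
theorem formDetPolarDD_smul (b : Fin 3 → ℝ) (c e : ℂ) (g g' h h' : ℝ → ℂ) :
    FormDetPolarDD b (c • g) (c • g') (e • h) (e • h') = c * conj e * FormDetPolarDD b g g' h h' := by
  rw [FormDetPolarDD, FormDetPolarDD, MformDD, MformDD, MformDD, MformDD, mformOf_smul_left, mformOf_smul_right,
    mformOf_smul_left, mformOf_smul_right]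
  simp only [map_mul, Complex.conj_conj]
  ring

/-! ### Part 2 — the block main-term form of an entangled design -/

/-- **The block main-term form `m(a;b;h) = Σ_j Σ_l P^{dd}_{(a,b_j,b_l)}(h_j,h_l) = hᵀ·BigF(a;b)·h`** of the
entangled detector with anchor `a`, palette `b : Fin K → ℝ` and profile vector `h` (marked derivatives `h′`):
the (A)-main-term functional the cell's derivation assigns to `Σ_ρ (iM′)²α³·x_a·|Σ_j x_jA_{h_j}|²·ω` (sum over
`(j,l)` of the class-DET monomial means with shift triple `(a,b_j,b_l)`; repeated triples by the confluent recipe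
`Det.FormDetPolarDD`). Design data — nothing asserts the derivation (registry E-010(i), E-080).
[cite: Zhang2022LandauSiegel, Prop 7.1 p.44, (7.19)–(7.21), (8.11)–(8.12)] -/
def entangledMain (a : ℝ) {K : ℕ} (b : Fin K → ℝ) (h h' : Fin K → ℝ → ℂ) : ℂ :=
  ∑ j, ∑ l, FormDetPolarDD ![a, b j, b l] (h j) (h' j) (h l) (h' l)

variable {K : ℕ}

/-- The block form is REAL: `conj m(a;b;h) = m(a;b;h)` (Hermitian blocks + symmetric moments + `Σ_{j,l} = Σ_{l,j}`).
[cite: Zhang2022LandauSiegel, Prop 7.1 p.44, (8.11)–(8.12)] -/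
theorem entangledMain_conj (a : ℝ) (b : Fin K → ℝ) (h h' : Fin K → ℝ → ℂ) :
    conj (entangledMain a b h h') = entangledMain a b h h' := by
  rw [entangledMain, map_sum, Finset.sum_comm]
  refine Finset.sum_congr rfl fun l _ => ?_
  rw [map_sum]
  refine Finset.sum_congr rfl fun j _ => ?_
  rw [formDetPolarDD_conj, formDetPolarDD_swap a (b j) (b l)]

/-- `Im m(a;b;h) = 0`. [cite: Zhang2022LandauSiegel, Prop 7.1 p.44, (8.11)–(8.12)] -/
theorem entangledMain_im (a : ℝ) (b : Fin K → ℝ) (h h' : Fin K → ℝ → ℂ) : (entangledMain a b h h').im = 0 := by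
  have hc := congrArg Complex.im (entangledMain_conj a b h h')
  rw [Complex.conj_im] at hc
  linarith

/-- `m(a;b;h) = Re m(a;b;h)` as a complex number. [cite: Zhang2022LandauSiegel, Prop 7.1 p.44, (8.11)–(8.12)] -/
theorem entangledMain_eq_re (a : ℝ) (b : Fin K → ℝ) (h h' : Fin K → ℝ → ℂ) :
    entangledMain a b h h' = ((entangledMain a b h h').re : ℂ) := by
  apply Complex.ext
  · simp
  · rw [entangledMain_im, Complex.ofReal_im]

/-- **`K = 1`: the single-profile member is the repeated-shift monomial `X_a·X_x²`** —
`m(a;(x);g) = P^{dd}_{(a,x,x)}(g,g)`, whose real part is `FormDetDD (a,x,x) g` (`formDetPolarDD_self_re`).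
[cite: Zhang2022LandauSiegel, Prop 7.1 p.44, (7.19)–(7.21)] -/
theorem entangledMain_fin_one (a : ℝ) (b : Fin 1 → ℝ) (h h' : Fin 1 → ℝ → ℂ) :
    entangledMain a b h h' = FormDetPolarDD ![a, b 0, b 0] (h 0) (h' 0) (h 0) (h' 0) := by
  simp [entangledMain]

/-- `Re m(a;(x);g) = FormDetDD (a,x,x) g`. [cite: Zhang2022LandauSiegel, Prop 7.1 p.44, (7.19)–(7.21)] -/
theorem entangledMain_fin_one_re (a : ℝ) (b : Fin 1 → ℝ) (h h' : Fin 1 → ℝ → ℂ) :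
    (entangledMain a b h h').re = FormDetDD ![a, b 0, b 0] (h 0) (h' 0) := by
  rw [entangledMain_fin_one, formDetPolarDD_self_re]

/-- **The RANK-ONE slice** `h_j = q_j•g` (theory's SOS family `X_a·|Σ_j q_jX_j|²`, ruling (c1)(5)):
`m(a;b;q•g) = Σ_j Σ_l q_j·conj(q_l)·FormDetDD(a,b_j,b_l)(g)` — the quadratic form of the `K×K` matrix of
diagonal recipe values in `q`. [cite: Zhang2022LandauSiegel, Prop 7.1 p.44, (7.19)–(7.21)] -/
theorem entangledMain_rankOne (a : ℝ) (b : Fin K → ℝ) (q : Fin K → ℂ) (g g' : ℝ → ℂ) :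
    entangledMain a b (fun j => q j • g) (fun j => q j • g')
      = ∑ j, ∑ l, q j * conj (q l) * (FormDetDD ![a, b j, b l] g g' : ℂ) := by
  unfold entangledMain
  refine Finset.sum_congr rfl fun j _ => Finset.sum_congr rfl fun l _ => ?_
  rw [formDetPolarDD_smul, ← formDetPolarDD_self_re]
  congr 1
  apply Complex.ext
  · simp
  · rw [formDetPolarDD_self_im, Complex.ofReal_im]

/-- Zero-extension of a profile vector along an injection `σ : Fin K′ → Fin K`: `h_{σ j} := h′_j`, `0` elsewhere.
[folklore] -/
def extendProfiles {K' : ℕ} (σ : Fin K' → Fin K) (h : Fin K' → ℝ → ℂ) : Fin K → ℝ → ℂ :=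
  fun i => if hi : ∃ j, σ j = i then h hi.choose else 0

/-- On the image the extension is the original profile. [folklore] -/
private theorem extendProfiles_apply {K' : ℕ} {σ : Fin K' → Fin K} (hσ : Function.Injective σ) (h : Fin K' → ℝ → ℂ)
    (j : Fin K') : extendProfiles σ h (σ j) = h j := by
  have hex : ∃ j', σ j' = σ j := ⟨j, rfl⟩
  rw [extendProfiles, dif_pos hex, hσ hex.choose_spec]

/-- Off the image the extension vanishes. [folklore] -/
private theorem extendProfiles_of_not_mem {K' : ℕ} (σ : Fin K' → Fin K) (h : Fin K' → ℝ → ℂ) {i : Fin K}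
    (hi : ¬ ∃ j, σ j = i) : extendProfiles σ h i = 0 := by
  rw [extendProfiles, dif_neg hi]

/-- **PRINCIPAL SUB-PALETTES**: the block form of the sub-palette `b ∘ σ` (`σ` injective) on profiles `h` equals
the block form of the full palette `b` on the zero-extended profile vector — `BigF(a; b∘σ)` is a principal
sub-block of `BigF(a;b)`. [cite: Zhang2022LandauSiegel, Prop 7.1 p.44, (8.11)–(8.12)] -/
theorem entangledMain_comp_eq {K' : ℕ} (a : ℝ) (b : Fin K → ℝ) {σ : Fin K' → Fin K}
    (hσ : Function.Injective σ) (h h' : Fin K' → ℝ → ℂ) :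
    entangledMain a (b ∘ σ) h h' = entangledMain a b (extendProfiles σ h) (extendProfiles σ h') := by
  classical
  unfold entangledMain
  -- the outer sum over `Fin K` is supported on the image of `σ`
  have hvan : ∀ i : Fin K, (¬ ∃ j, σ j = i) →
      ∀ i' : Fin K, FormDetPolarDD ![a, b i, b i'] (extendProfiles σ h i) (extendProfiles σ h' i)
        (extendProfiles σ h i') (extendProfiles σ h' i') = 0 := by
    intro i hi i'
    rw [extendProfiles_of_not_mem σ h hi, extendProfiles_of_not_mem σ h' hi, formDetPolarDD_zero_left]
  have hvan' : ∀ i' : Fin K, (¬ ∃ j, σ j = i') →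
      ∀ i : Fin K, FormDetPolarDD ![a, b i, b i'] (extendProfiles σ h i) (extendProfiles σ h' i)
        (extendProfiles σ h i') (extendProfiles σ h' i') = 0 := by
    intro i' hi' i
    rw [extendProfiles_of_not_mem σ h hi', extendProfiles_of_not_mem σ h' hi', formDetPolarDD_zero_right]
  have himage : (Finset.univ : Finset (Fin K')).image σ ⊆ Finset.univ := Finset.subset_univ _
  symm
  rw [← Finset.sum_subset himage (fun i _ hi => by
        have hi' : ¬ ∃ j, σ j = i := by
          rintro ⟨j, rfl⟩
          exact hi (Finset.mem_image_of_mem σ (Finset.mem_univ j))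
        exact Finset.sum_eq_zero fun i' _ => hvan i hi' i'),
    Finset.sum_image (fun j _ j' _ e => hσ e)]
  refine Finset.sum_congr rfl fun j _ => ?_
  rw [← Finset.sum_subset himage (fun i' _ hi' => by
        have hi'' : ¬ ∃ j, σ j = i' := by
          rintro ⟨j', rfl⟩
          exact hi' (Finset.mem_image_of_mem σ (Finset.mem_univ j'))
        exact hvan' i' hi'' (σ j)),
    Finset.sum_image (fun j _ j' _ e => hσ e)]
  refine Finset.sum_congr rfl fun l _ => ?_
  simp only [Function.comp_apply, extendProfiles_apply hσ]

/-! ### Part 3 — statement vocabulary: the cone member, its negation, the row det-E15 (bare `Prop`s, none asserted) -/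

/-- **One MEMBER of the cone row: `BigF(a;b) ⪰ 0` on one-sided kinked profiles** — for every profile vector of
one-sided kinked top-vanishing profiles (`Repair.KinkedProfile`, `h_j(1) = 0`: the range (7.2) class of Prop 7.1)
the block main-term form is `≥ 0`. Decidable in-house per member by certified eigen-bounds on the Legendre
classes (design sub-family det-D2⁺); for `K = 1`, `b = (x)` it is «`FormDetDD (a,x,x) ≥ 0`» (`conePSD_fin_one_iff`).
Stated, never asserted. [cite: Zhang2022LandauSiegel, Prop 7.1 p.44, (7.2), (7.19)–(7.21)] -/
def ConePSD (a : ℝ) {K : ℕ} (b : Fin K → ℝ) : Prop :=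
  ∀ h h' : Fin K → ℝ → ℂ, (∀ j, KinkedProfile (h j) (h' j)) → (∀ j, h j 1 = 0) →
    0 ≤ (entangledMain a b h h').re

/-- **The negation with a witness — the CANDIDATE event of R-d2p-1**: some one-sided kinked profile vector has
`Re m(a;b;h) < 0` (a certified negative direction of `BigF(a;b)`). [cite: Zhang2022LandauSiegel, Prop 7.1 p.44, (7.2)] -/
def ConeNegWitness (a : ℝ) {K : ℕ} (b : Fin K → ℝ) : Prop :=
  ∃ h h' : Fin K → ℝ → ℂ, (∀ j, KinkedProfile (h j) (h' j)) ∧ (∀ j, h j 1 = 0) ∧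
    (entangledMain a b h h').re < 0

/-- `¬ ConePSD a b ↔ ConeNegWitness a b`. [cite: Zhang2022LandauSiegel, Prop 7.1 p.44, (7.2)] -/
theorem not_conePSD_iff (a : ℝ) (b : Fin K → ℝ) : ¬ ConePSD a b ↔ ConeNegWitness a b := by
  simp only [ConePSD, ConeNegWitness, not_forall, not_le, exists_prop]

/-- **det-E15 «E-det-cone» (registry E-102) ON an anchor set `A` and a shift box `B`**: every member with anchor
`a ∈ A` and palette values in `B` is PSD. The row of record (EDLIST v1.3; the open row named by the family word,
KILL-draft v1.7 §1a) is `EdetCone (Set.Ioo 0 1) (Set.Ioo 0 5)` («for every anchor with `N_a = 0` and every finite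
palette in `(0,5)`»); the grid scanned by det-D2⁺ is `A = {¼,½,¾}` (`a = 1` tolerance-flagged), `B = ¼ℤ ∩ (0,5)`.
OPEN (in-house; «B-AH restricted to DET»; per member decidable, continuum open; price per member S, continuum M–L,
verdict-inert) — stated, never asserted; never a theorem or an axiom of this tree until proved.
[cite: Zhang2022LandauSiegel, Prop 7.1 p.44, (7.2), (7.19)–(7.21); Lemma 2.3 p.6] -/
def EdetCone (A B : Set ℝ) : Prop :=
  ∀ (K : ℕ) (a : ℝ), a ∈ A → ∀ b : Fin K → ℝ, (∀ j, b j ∈ B) → ConePSD a b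

/-- The row is ANTITONE in the anchor set and the shift box (a smaller grid is a weaker statement).
[cite: Zhang2022LandauSiegel, Prop 7.1 p.44, (7.2)] -/
theorem EdetCone.mono {A A' B B' : Set ℝ} (hE : EdetCone A B) (hA : A' ⊆ A) (hB : B' ⊆ B) : EdetCone A' B' :=
  fun K a ha b hb => hE K a (hA ha) b fun j => hB (hb j)

/-- Accessor: the row delivers each of its members. [cite: Zhang2022LandauSiegel, Prop 7.1 p.44, (7.2)] -/
theorem EdetCone.conePSD {A B : Set ℝ} (hE : EdetCone A B) {a : ℝ} (ha : a ∈ A) {b : Fin K → ℝ}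
    (hb : ∀ j, b j ∈ B) : ConePSD a b :=
  hE K a ha b hb

/-- The zero profile (with zero marked derivative) is a one-sided kinked profile (the empty coefficient sequence).
[cite: Zhang2022LandauSiegel, Prop 7.1 with (8.11)–(8.23), pp.44–50] -/
theorem kinkedProfile_zero : KinkedProfile (0 : ℝ → ℂ) 0 where
  cont := continuousOn_const
  hasDeriv := fun x _ => hasDerivWithinAt_const x (Set.Ioi x) (0 : ℂ)
  memLp := MeasureTheory.memLp_const (0 : ℂ)

/-- Zero-extension preserves the profile class. [folklore] -/
private theorem kinkedProfile_extendProfiles {K' : ℕ} (σ : Fin K' → Fin K) {h h' : Fin K' → ℝ → ℂ}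
    (hk : ∀ j, KinkedProfile (h j) (h' j)) (i : Fin K) :
    KinkedProfile (extendProfiles σ h i) (extendProfiles σ h' i) := by
  unfold extendProfiles
  split_ifs with hi
  · exact hk _
  · exact kinkedProfile_zero

/-- Zero-extension preserves top-vanishing. [folklore] -/
private theorem extendProfiles_apex {K' : ℕ} (σ : Fin K' → Fin K) {h : Fin K' → ℝ → ℂ} (h1 : ∀ j, h j 1 = 0)
    (i : Fin K) : extendProfiles σ h i 1 = 0 := by
  unfold extendProfiles
  split_ifs with hi
  · exact h1 _
  · rfl

/-- **PSD is inherited by principal sub-palettes**: `ConePSD a b → ConePSD a (b ∘ σ)` for injective `σ`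
(one certified `BigF(a;Π)` per anchor settles every sub-palette, D2PLUS-SPEC §2).
[cite: Zhang2022LandauSiegel, Prop 7.1 p.44, (7.2)] -/
theorem ConePSD.comp {K' : ℕ} {a : ℝ} {b : Fin K → ℝ} (hP : ConePSD a b) {σ : Fin K' → Fin K}
    (hσ : Function.Injective σ) : ConePSD a (b ∘ σ) := by
  intro h h' hk h1
  rw [entangledMain_comp_eq a b hσ h h']
  exact hP _ _ (kinkedProfile_extendProfiles σ hk) (extendProfiles_apex σ h1)

/-- **Diagonal members**: a PSD block matrix has non-negative diagonal recipe values —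
`ConePSD a b → FormDetDD (a,b_j,b_j)(g) ≥ 0` on one-sided kinked profiles, for every palette index `j`
(the repeated-shift monomial `X_a·X_{b_j}²`). [cite: Zhang2022LandauSiegel, Prop 7.1 p.44, (7.2), (7.19)–(7.21)] -/
theorem ConePSD.formDetDD_nonneg {a : ℝ} {b : Fin K → ℝ} (hP : ConePSD a b) (j : Fin K) {g g' : ℝ → ℂ}
    (hg : KinkedProfile g g') (hg1 : g 1 = 0) : 0 ≤ FormDetDD ![a, b j, b j] g g' := by
  have hσ : Function.Injective (fun _ : Fin 1 => j) := fun x y _ => Subsingleton.elim x y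
  have h1 := (hP.comp hσ) (fun _ => g) (fun _ => g') (fun _ => hg) (fun _ => hg1)
  rwa [entangledMain_fin_one_re] at h1

/-- The `K = 1` member IS the statement «`FormDetDD (a,x,x) ≥ 0` on one-sided kinked profiles».
[cite: Zhang2022LandauSiegel, Prop 7.1 p.44, (7.2), (7.19)–(7.21)] -/
theorem conePSD_fin_one_iff (a x : ℝ) :
    ConePSD a ![x] ↔ ∀ g g' : ℝ → ℂ, KinkedProfile g g' → g 1 = 0 → 0 ≤ FormDetDD ![a, x, x] g g' := by
  constructor
  · intro hP g g' hg hg1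
    simpa using hP.formDetDD_nonneg 0 hg hg1
  · intro hF h h' hk h1
    rw [entangledMain_fin_one_re]
    simpa using hF (h 0) (h' 0) (hk 0) (h1 0)

/-- **An entangled design of class DET (widened clause (i′))** as data: an anchor `a ∈ (0,1)` (anchor variable
`x_a > 0` on every Prop-2.2 configuration: no `ψ`-site in `(0,a)`) and a palette of `K` shift multiples in `(0,5)`;
the detector weight is `(iM′)²α³·x_a·|Σ_j x_jA_{h_j}|²·ω` for a profile vector `h` chosen at evaluation.
[cite: Zhang2022LandauSiegel, §2 (2.13)–(2.15), Lemma 2.3 p.6] -/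
structure EntangledDesign (K : ℕ) where
  /-- the anchor shift multiple `b_a` -/
  a : ℝ
  /-- `b_a ∈ (0,1)` -/
  a_mem : 0 < a ∧ a < 1
  /-- the palette `b_1, …, b_K` -/
  b : Fin K → ℝ
  /-- `b_j ∈ (0,5)` -/
  b_mem : ∀ j, 0 < b j ∧ b j < 5

namespace EntangledDesign

variable (d : EntangledDesign K)

/-- The main-term functional of an entangled design on a profile vector: `hᵀ·BigF(a;b)·h`.
[cite: Zhang2022LandauSiegel, Prop 7.1 p.44, (8.11)–(8.12)] -/
def mainTerm (h h' : Fin K → ℝ → ℂ) : ℂ := entangledMain d.a d.b h h'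

/-- `mainTerm` unfolds to `entangledMain`. [cite: Zhang2022LandauSiegel, Prop 7.1 p.44, (8.11)–(8.12)] -/
theorem mainTerm_eq (h h' : Fin K → ℝ → ℂ) : d.mainTerm h h' = entangledMain d.a d.b h h' := rfl

/-- The main term of an entangled design is real. [cite: Zhang2022LandauSiegel, Prop 7.1 p.44, (8.11)–(8.12)] -/
theorem mainTerm_im (h h' : Fin K → ℝ → ℂ) : (d.mainTerm h h').im = 0 := entangledMain_im _ _ _ _

/-- **GIVEN the row det-E15 on `(0,1) × (0,5)`, every entangled design's block matrix is PSD** (how the family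
word consumes the row: «decided on the scanned generators, GIVEN det-E15 on the continuum»).
[cite: Zhang2022LandauSiegel, Prop 7.1 p.44, (7.2)] -/
theorem conePSD (hE : EdetCone (Set.Ioo 0 1) (Set.Ioo 0 5)) : ConePSD d.a d.b :=
  hE.conePSD d.a_mem fun j => d.b_mem j

end EntangledDesign

/-! ### Part 4 — the discrete side: validity of the entangled statistic, its monomial expansion, main order -/

section Discrete

variable {ι : Type*} (Z : Finset ι)

/-- **The entangled statistic of one configuration**: `Ξ_{w·x_a}(u,u)` with `u(ρ) = Σ_j x_j(ρ)A_j(ρ)` — the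
discrete form (`Det.discreteForm`) of the weight `w(ρ)x_a(ρ)` on the single test family `u` (the manuscript's
POS-type mean (2.16) for the detector `(iM′)²α³x_a|Σ_jx_jA_{h_j}|²ω`: `w = (iM′Y)²α³ω`, `x_j` the real normalised
shifted `M`-values, `A_j = A_{h_j}(ρ,ψ)`). [cite: Zhang2022LandauSiegel, §2 (2.15)–(2.17)] -/
def entangledStat (w xa : ι → ℝ) (x : Fin K → ι → ℝ) (A : Fin K → ι → ℂ) : ℂ :=
  discreteForm Z (fun ρ => w ρ * xa ρ) (fun ρ => ∑ j, (x j ρ : ℂ) * A j ρ) (fun ρ => ∑ j, (x j ρ : ℂ) * A j ρ)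

/-- **VALIDITY (pointwise, D2PLUS-SPEC §5 A4)**: for `w ≥ 0` and `x_a ≥ 0` on the configuration the entangled
statistic is `≥ 0` — no sign pattern on the palette is needed («`x_a > 0` since `N_a = 0`; the rest is a square»).
[cite: Zhang2022LandauSiegel, §2 (2.16), Lemma 2.3 p.6] -/
theorem entangledStat_re_nonneg {w xa : ι → ℝ} (hw : ∀ ρ ∈ Z, 0 ≤ w ρ) (hxa : ∀ ρ ∈ Z, 0 ≤ xa ρ)
    (x : Fin K → ι → ℝ) (A : Fin K → ι → ℂ) : 0 ≤ (entangledStat Z w xa x A).re :=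
  discreteForm_self_nonneg (Z := Z) (fun ρ hρ => mul_nonneg (hw ρ hρ) (hxa ρ hρ)) _

/-- Its imaginary part vanishes. [cite: Zhang2022LandauSiegel, §2 (2.16)] -/
theorem entangledStat_im (w xa : ι → ℝ) (x : Fin K → ι → ℝ) (A : Fin K → ι → ℂ) :
    (entangledStat Z w xa x A).im = 0 :=
  discreteForm_self_im _ _ _

/-- **MONOMIAL EXPANSION (class membership, R-d2p-2)**: the entangled statistic is the double sum over `(j,l)`
of the discrete means with the MONOMIAL weights `w·x_a·x_j·x_l` on the profile pair `(A_j, A_l)` — each term a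
class-DET member with `≤ 3` shifts `(a, b_j, b_l)`. [cite: Zhang2022LandauSiegel, §2 (2.15)–(2.17)] -/
theorem entangledStat_eq_sum (w xa : ι → ℝ) (x : Fin K → ι → ℝ) (A : Fin K → ι → ℂ) :
    entangledStat Z w xa x A
      = ∑ j, ∑ l, discreteForm Z (fun ρ => w ρ * xa ρ * x j ρ * x l ρ) (A j) (A l) := by
  have key : ∀ ρ, ((w ρ * xa ρ : ℝ) : ℂ) *
      ((∑ j, (x j ρ : ℂ) * A j ρ) * conj (∑ j, (x j ρ : ℂ) * A j ρ))
        = ∑ j, ∑ l, ((w ρ * xa ρ * x j ρ * x l ρ : ℝ) : ℂ) * (A j ρ * conj (A l ρ)) := by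
    intro ρ
    rw [map_sum, Finset.sum_mul_sum, Finset.mul_sum]
    refine Finset.sum_congr rfl fun j _ => ?_
    rw [Finset.mul_sum]
    refine Finset.sum_congr rfl fun l _ => ?_
    simp only [map_mul, Complex.conj_ofReal]
    push_cast
    ring
  simp only [entangledStat, discreteForm]
  rw [Finset.sum_congr rfl fun ρ _ => key ρ, Finset.sum_comm]
  refine Finset.sum_congr rfl fun j _ => ?_
  rw [Finset.sum_comm]

end Discrete

/-- **Main-order soundness of the POS endgame** (the form used by the candidate criterion): along any filter of
stages, a statistic that is `≥ 0` at every stage, normalised by scales `X > 0`, cannot converge to a negative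
main-term constant. [cite: Zhang2022LandauSiegel, §2 (2.16), (2.32)] -/
theorem entangled_mainOrder_nonneg {α : Type*} {l : Filter α} [l.NeBot] {S X : α → ℝ} {m : ℝ}
    (hS : ∀ᶠ s in l, 0 ≤ S s) (hX : ∀ᶠ s in l, 0 < X s) (hlim : Tendsto (fun s => S s / X s) l (𝓝 m)) :
    0 ≤ m := by
  refine ge_of_tendsto hlim ?_
  filter_upwards [hS, hX] with s hSs hXs
  exact div_nonneg hSs hXs.le

/-- **The CANDIDATE CRITERION of D2PLUS-SPEC §1 in kernel shape**: if a member's main-term constant is NEGATIVE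
(`Re m(a;b;h*) < 0`, a `ConeNegWitness`), then NO non-negative statistic normalised by positive scales tends to it
— so an (A)-asymptotic «`𝒟 ∼ m·𝔞𝔓`» for the (pointwise non-negative) entangled statistic would be contradicted
at main order: the conjunction (A) ∧ E-010(i) ∧ repeated-shift rule ∧ det-E2 cannot hold. Nothing here asserts
that any member is negative. [cite: Zhang2022LandauSiegel, §2 (2.16), (2.32); Prop 7.1 p.44] -/
theorem not_tendsto_of_neg {α : Type*} {l : Filter α} [l.NeBot] {S X : α → ℝ} {m : ℝ} (hm : m < 0)
    (hS : ∀ᶠ s in l, 0 ≤ S s) (hX : ∀ᶠ s in l, 0 < X s) : ¬ Tendsto (fun s => S s / X s) l (𝓝 m) :=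
  fun hlim => absurd (entangled_mainOrder_nonneg hS hX hlim) (not_le.mpr hm)


/-! ### Part 5 (v2) — the word's FULL premise as one name: entangled cone ∧ monomial cone (referee rider F-E102-1) -/

/-- **The MONOMIAL cone on a shift box `B`** (registry E-010 (ii), ∀-form): for every sign-admissible shift triple `b`
(`Det.SignAdmissible`, the Lemma-2.3 shape — sorted, pairwise distinct) with entries in `B`, the recipe form `𝔅_{R(b)}` is
PSD on one-sided kinked profiles (`Det.FormDetPSD (Det.shiftRecipe b)` — the per-member slot `Repair.familyDetShift` displays).
For `B = (0,5)` the entry condition is `Det.InShiftBox`. Stated, never asserted; in-tree members `(1,2,3)` and `(1/2; 2, 5/2)`.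
[cite: Zhang2022LandauSiegel, §2 (2.13), Lemma 2.3 p.6; Prop 7.1 p.44, (7.2)] -/
def MonomialConePSD (B : Set ℝ) : Prop :=
  ∀ b : Fin 3 → ℝ, SignAdmissible b → (∀ j, b j ∈ B) → FormDetPSD (shiftRecipe b)

/-- **The FULL premise «det-E15 E-det-cone on the continuum» of the family word (registry E-102) ON `(A, B)`**: the
entangled/block cone `EdetCone A B` AND the monomial cone `MonomialConePSD B` (theory ruling (c1)(6): `FormDet ⪰ 0` on
one-sided kinked profiles for every ConfigPositive generator — monomial and entangled). Row of record:
`EdetPremise (Set.Ioo 0 1) (Set.Ioo 0 5)`. OPEN (in-house); per member decidable; stated, never asserted.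
[cite: Zhang2022LandauSiegel, §2 (2.13), Lemma 2.3 p.6; Prop 7.1 p.44, (7.2), (7.19)–(7.21)] -/
def EdetPremise (A B : Set ℝ) : Prop :=
  EdetCone A B ∧ MonomialConePSD B

/-- The row of record unfolded: `EdetPremise (0,1) (0,5) ↔ EdetCone (0,1) (0,5) ∧ ∀ b, SignAdmissible b → InShiftBox b →
FormDetPSD (shiftRecipe b)`. [cite: Zhang2022LandauSiegel, §2 (2.13), Lemma 2.3 p.6; Prop 7.1 p.44, (7.2)] -/
theorem edetPremise_record_iff :
    EdetPremise (Set.Ioo 0 1) (Set.Ioo 0 5) ↔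
      EdetCone (Set.Ioo 0 1) (Set.Ioo 0 5) ∧
        ∀ b : Fin 3 → ℝ, SignAdmissible b → InShiftBox b → FormDetPSD (shiftRecipe b) :=
  Iff.rfl

/-- Accessor: the entangled-cone conjunct. [cite: Zhang2022LandauSiegel, Prop 7.1 p.44, (7.2)] -/
theorem EdetPremise.edetCone {A B : Set ℝ} (h : EdetPremise A B) : EdetCone A B := h.1

/-- Accessor: the monomial-cone conjunct, per member. [cite: Zhang2022LandauSiegel, Prop 7.1 p.44, (7.2)] -/
theorem EdetPremise.formDetPSD {A B : Set ℝ} (h : EdetPremise A B) {b : Fin 3 → ℝ} (hb : SignAdmissible b)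
    (hB : ∀ j, b j ∈ B) : FormDetPSD (shiftRecipe b) :=
  h.2 b hb hB

/-- The monomial cone is antitone in the box. [cite: Zhang2022LandauSiegel, Prop 7.1 p.44, (7.2)] -/
theorem MonomialConePSD.mono {B B' : Set ℝ} (h : MonomialConePSD B) (hB : B' ⊆ B) : MonomialConePSD B' :=
  fun b hb hB' => h b hb fun j => hB (hB' j)

/-- The full premise is antitone in the anchor set and the box. [cite: Zhang2022LandauSiegel, Prop 7.1 p.44, (7.2)] -/
theorem EdetPremise.mono {A A' B B' : Set ℝ} (h : EdetPremise A B) (hA : A' ⊆ A) (hB : B' ⊆ B) : EdetPremise A' B' :=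
  ⟨h.1.mono hA hB, h.2.mono hB⟩

/-- **The printed member of the monomial cone is a theorem**: `(1,2,3)` is sign-admissible, in the box, and its recipe
form is PSD (`Det.formDetPSD_shiftRecipe_std`) — one member of `MonomialConePSD (Set.Ioo 0 5)` discharged in tree (the
second in-tree member, `(1/2; 2, 5/2)`, is `Det.formDetPSD_shiftRecipe_bStar` in `RepairDetShiftPSD`).
[cite: Zhang2022LandauSiegel, Prop 7.1 with (8.11)–(8.23), pp.44–50; §2 Lemma 2.3] -/
theorem monomialConePSD_std_member :
    SignAdmissible ![1, 2, 3] ∧ InShiftBox ![1, 2, 3] ∧ FormDetPSD (shiftRecipe ![1, 2, 3]) :=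
  ⟨signAdmissible_std, inShiftBox_std, formDetPSD_shiftRecipe_std⟩

/-- GIVEN the full premise of record, every sign-admissible shift detector in the box has a PSD recipe form AND every
entangled design's block matrix is PSD (how qualifier (b) of the word reads: BOTH conjuncts).
[cite: Zhang2022LandauSiegel, §2 (2.13), Lemma 2.3 p.6; Prop 7.1 p.44, (7.2)] -/
theorem EdetPremise.record_members (h : EdetPremise (Set.Ioo 0 1) (Set.Ioo 0 5)) :
    (∀ b : Fin 3 → ℝ, SignAdmissible b → InShiftBox b → FormDetPSD (shiftRecipe b)) ∧
      ∀ (K : ℕ) (d : EntangledDesign K), ConePSD d.a d.b :=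
  ⟨fun _ hb hB => h.formDetPSD hb hB, fun _ d => d.conePSD h.edetCone⟩

end Det

end Literature.NumberTheory.LFunctions.Zhang2022
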